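import Literature.NumberTheory.LFunctions.SuzukiSingleOperatorKernelProofs
import Mathlib.Analysis.Fourier.Convolution
import Mathlib.Analysis.Fourier.Inversion

/-!
# Suzuki's single-operator kernels form a convolution semigroup in `θ` (column DBR; RH-FREE)

RH-FREE throughout; nothing here bears on the truth of RH.

Card A of the cell rh-dbr's ideation (`theta-semigroup-clean-radius`, rh-dbr-idea-1; banked target `KernelSemigroup`,
HOME/rh-dbr-idea-1/Sketch.lean): the symbol of [Su20] (1.9) is an exponential in `θ`,
`Θ_θ(z) = exp(−2θ ξ'/ξ(½ − iz))`, so `Θ_{θ₁+θ₂} = Θ_{θ₁} Θ_{θ₂}` and the kernels `K_θ` (the tree's spectrally defined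
`limKernel θ`, [Su20] Thm 1.2) form a ONE-SIDED CONVOLUTION SEMIGROUP:

* `limKernel_add_eq_integral` — for `θ₁, θ₂ > 1` and every real `x`,
  `K_{θ₁+θ₂}(x) = ∫_ℝ K_{θ₁}(t) K_{θ₂}(x − t) dt`;
* `limKernel_add_eq_setIntegral_Ioo` (the typed `KernelSemigroup` shape) —
  `K_{θ₁+θ₂}(x) = ∫_{(0,x)} K_{θ₁}(x − y) K_{θ₂}(y) dy` (the kernels vanish on `(−∞, 0]`).

Proof (RH-free, no zero of `ζ` enters): with `f_θ(x) := K_θ(x)e^{−x}` — continuous, bounded, integrable, and by the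
tree's Fourier formula (`Suzuki2020_thm12_fourier`, line `Im z = 1`) `𝓕 f_θ(ξ) = Θ_θ(−2πξ + i)` — Mathlib's convolution
theorem (`Real.fourier_mul_convolution_eq`) gives `𝓕(f_{θ₁} ⋆ f_{θ₂}) = Θ_{θ₁}Θ_{θ₂} = Θ_{θ₁+θ₂} = 𝓕 f_{θ₁+θ₂}` on that
line; both sides are continuous and integrable with integrable transform (`integrable_limTheta_line`), so Fourier
inversion (`Continuous.fourierInv_fourier_eq`) identifies them pointwise.  This is the integrated form of the
`θ`-flow `∂_θ K_θ = k ∗ K_θ` (rh-dbr-idea-2, `theta-flow-weil-window`).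

References: [Su20] M. Suzuki, *Integral operators arising from the Riemann zeta function*, ASPM 84 (2020) 399–411
= arXiv:1907.07302, (1.9) and Thm 1.2 (K-ii), (K-iii).
-/

noncomputable section

-- D-0017: `Summit.<S>.<S>.…` is the designed namespace of a single-problem summit.
set_option linter.dupNamespace false

open Complex MeasureTheory Filter Topology Set
open scoped Real FourierTransform Convolution

namespace Summit.RiemannHypothesis.RiemannHypothesis.Theorems.SuzukiKernelSemigroup

open Literature.NumberTheory.LFunctions

/-! ## §1 The damped kernel `f_θ(x) = K_θ(x) e^{−x}` -/

/-- RH-FREE.  The symbol is multiplicative in `θ`: `Θ_{θ₁+θ₂}(z) = Θ_{θ₁}(z) Θ_{θ₂}(z)`. -/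
theorem limTheta_add (θ₁ θ₂ : ℝ) (z : ℂ) : limTheta (θ₁ + θ₂) z = limTheta θ₁ z * limTheta θ₂ z := by
  unfold limTheta
  rw [← Complex.exp_add]
  congr 1
  push_cast
  ring

/-- RH-FREE.  `f_θ` is continuous (`θ > 1`). -/
theorem continuous_damped {θ : ℝ} (hθ : 1 < θ) :
    Continuous fun y : ℝ => (limKernel θ y : ℂ) * Complex.exp (-(y : ℂ)) :=
  (Complex.continuous_ofReal.comp (Suzuki2020_thm12_continuous hθ)).mul (by fun_prop)

/-- RH-FREE.  `f_θ` vanishes on `(−∞, 0)` (`θ > 1`; [Su20] (K-iii)). -/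
theorem damped_eq_zero_of_neg {θ : ℝ} (hθ : 1 < θ) {y : ℝ} (hy : y < 0) :
    (limKernel θ y : ℂ) * Complex.exp (-(y : ℂ)) = 0 := by
  rw [Suzuki2020_thm12_Kiii hθ hy]; simp

/-- RH-FREE.  `K_θ(0) = 0` (`θ > 1`): continuity and vanishing on `(−∞,0)`. -/
theorem limKernel_zero {θ : ℝ} (hθ : 1 < θ) : limKernel θ 0 = 0 := by
  have hc := (Suzuki2020_thm12_continuous hθ).continuousAt (x := 0)
  have hlim : Tendsto (limKernel θ) (𝓝[<] (0 : ℝ)) (𝓝 0) := by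
    apply tendsto_const_nhds.congr'
    filter_upwards [self_mem_nhdsWithin] with y hy
    exact (Suzuki2020_thm12_Kiii hθ hy).symm
  exact tendsto_nhds_unique (hc.tendsto.mono_left nhdsWithin_le_nhds) hlim

/-- RH-FREE.  A uniform exponential bound: `‖f_θ(y)‖ ≤ D e^{−y/4}` for `y ≥ 0` and `= 0` for `y < 0`, packaged as
`‖f_θ(y)‖ ≤ D · 𝟙_{[0,∞)}(y) e^{−y/4}` (growth `|K_θ(y)| ≤ D e^{3y/4}` from the line `Im z = 3/4`). -/
theorem norm_damped_le {θ : ℝ} (hθ : 1 < θ) :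
    ∃ D : ℝ, 0 ≤ D ∧ ∀ y : ℝ, ‖(limKernel θ y : ℂ) * Complex.exp (-(y : ℂ))‖ ≤
      Set.indicator (Ici (0 : ℝ)) (fun y : ℝ => D * Real.exp (-(y / 4))) y := by
  obtain ⟨D, hD0, hD⟩ := abs_limKernel_le hθ (b := 3 / 4) (by norm_num)
  refine ⟨D, hD0, fun y => ?_⟩
  rcases lt_or_ge y 0 with hy | hy
  · rw [damped_eq_zero_of_neg hθ hy, norm_zero, Set.indicator_of_notMem (by simpa using hy)]
  · rw [Set.indicator_of_mem (by simpa using hy), norm_mul, Complex.norm_real, Real.norm_eq_abs,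
      ← Complex.ofReal_neg, Complex.norm_exp_ofReal]
    calc |limKernel θ y| * Real.exp (-y) ≤ D * Real.exp (3 / 4 * y) * Real.exp (-y) :=
          mul_le_mul_of_nonneg_right (hD y) (Real.exp_pos _).le
      _ = D * Real.exp (-(y / 4)) := by rw [mul_assoc, ← Real.exp_add]; ring_nf

/-- RH-FREE.  `f_θ` is bounded. -/
theorem bddAbove_norm_damped {θ : ℝ} (hθ : 1 < θ) :
    BddAbove (range fun y : ℝ => ‖(limKernel θ y : ℂ) * Complex.exp (-(y : ℂ))‖) := by
  obtain ⟨D, hD0, hD⟩ := norm_damped_le hθ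
  refine ⟨D, ?_⟩
  rintro _ ⟨y, rfl⟩
  refine (hD y).trans ?_
  rcases lt_or_ge y 0 with hy | hy
  · rw [Set.indicator_of_notMem (by simpa using hy)]; exact hD0
  · rw [Set.indicator_of_mem (by simpa using hy)]
    have : Real.exp (-(y / 4)) ≤ 1 := Real.exp_le_one_iff.2 (by linarith)
    nlinarith

/-- RH-FREE.  `f_θ` is integrable on `ℝ` (`θ > 1`). -/
theorem integrable_damped {θ : ℝ} (hθ : 1 < θ) :
    Integrable fun y : ℝ => (limKernel θ y : ℂ) * Complex.exp (-(y : ℂ)) := by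
  obtain ⟨D, _, hD⟩ := norm_damped_le hθ
  have hmaj : Integrable (Set.indicator (Ici (0 : ℝ)) fun y : ℝ => D * Real.exp (-(y / 4))) := by
    refine IntegrableOn.integrable_indicator ?_ measurableSet_Ici
    rw [integrableOn_Ici_iff_integrableOn_Ioi]
    have h := (exp_neg_integrableOn_Ioi 0 (by norm_num : (0 : ℝ) < 1 / 4)).const_mul D
    refine h.congr (Eventually.of_forall fun y => ?_)
    simp only
    rw [show -(1 / 4 : ℝ) * y = -(y / 4) by ring]
  exact hmaj.mono' (continuous_damped hθ).aestronglyMeasurable (Eventually.of_forall hD)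

/-! ## §2 The Fourier transform of the damped kernel is the symbol on the line `Im z = 1` -/

/-- RH-FREE.  `𝓕 f_θ(ξ) = Θ_θ(−2πξ + i)` (`θ > 1`): Mathlib's `𝓕 f(ξ) = ∫ e^{−2πi yξ} f(y) dy` and the tree's
Fourier formula `∫ K_θ(y) e^{izy} dy = Θ_θ(z)` at `z = −2πξ + i` (`Im z = 1 > ½`). -/
theorem fourier_damped {θ : ℝ} (hθ : 1 < θ) (ξ : ℝ) :
    𝓕 (fun y : ℝ => (limKernel θ y : ℂ) * Complex.exp (-(y : ℂ))) ξ =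
      limTheta θ (((-2 * π * ξ : ℝ) : ℂ) + I) := by
  set z : ℂ := ((-2 * π * ξ : ℝ) : ℂ) + I with hz
  have hzim : 1 / 2 < z.im := by norm_num [hz]
  have h := (Suzuki2020_thm12_fourier hθ hzim).2
  rw [Real.fourier_real_eq_integral_exp_smul, ← h]
  congr 1
  funext y
  rw [smul_eq_mul, hz]
  have e : Complex.exp (↑(-2 * π * y * ξ) * I) * Complex.exp (-(y : ℂ)) =
      Complex.exp (I * (((-2 * π * ξ : ℝ) : ℂ) + I) * (y : ℂ)) := by
    rw [← Complex.exp_add]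
    congr 1
    push_cast
    linear_combination (-(y : ℂ)) * I_mul_I
  calc Complex.exp (↑(-2 * π * y * ξ) * I) * ((limKernel θ y : ℂ) * Complex.exp (-(y : ℂ)))
      = (limKernel θ y : ℂ) * (Complex.exp (↑(-2 * π * y * ξ) * I) * Complex.exp (-(y : ℂ))) := by ring
    _ = (limKernel θ y : ℂ) * Complex.exp (I * (((-2 * π * ξ : ℝ) : ℂ) + I) * (y : ℂ)) := by rw [e]

/-- RH-FREE.  The transform of the damped kernel is integrable (`θ > 1`; `Θ_θ` is integrable along `Im z = 1`). -/
theorem integrable_fourier_damped {θ : ℝ} (hθ : 1 < θ) :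
    Integrable (𝓕 (fun y : ℝ => (limKernel θ y : ℂ) * Complex.exp (-(y : ℂ)))) := by
  have hI := integrable_limTheta_line hθ (b := 1) (by norm_num)
  have h2 : Integrable fun ξ : ℝ => limTheta θ ((((-(2 * π)) * ξ : ℝ) : ℂ) + ((1 : ℝ) : ℂ) * I) :=
    hI.comp_mul_left' (neg_ne_zero.2 (by positivity))
  have hpt : ∀ ξ : ℝ, limTheta θ ((((-(2 * π)) * ξ : ℝ) : ℂ) + ((1 : ℝ) : ℂ) * I) =
      𝓕 (fun y : ℝ => (limKernel θ y : ℂ) * Complex.exp (-(y : ℂ))) ξ := by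
    intro ξ
    have e : ((((-(2 * π)) * ξ : ℝ)) : ℂ) + ((1 : ℝ) : ℂ) * I = (((-2 * π * ξ : ℝ)) : ℂ) + I := by
      push_cast; ring
    rw [fourier_damped hθ ξ, e]
  exact h2.congr (Eventually.of_forall hpt)

/-! ## §3 The convolution `f_{θ₁} ⋆ f_{θ₂}` and its transform -/

/-- RH-FREE.  The convolution of two damped kernels is integrable. -/
theorem integrable_conv_damped {θ₁ θ₂ : ℝ} (h₁ : 1 < θ₁) (h₂ : 1 < θ₂) :
    Integrable ((fun y : ℝ => (limKernel θ₁ y : ℂ) * Complex.exp (-(y : ℂ))) ⋆[ContinuousLinearMap.mul ℂ ℂ]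
      (fun y : ℝ => (limKernel θ₂ y : ℂ) * Complex.exp (-(y : ℂ)))) :=
  (integrable_damped h₁).integrable_convolution _ (integrable_damped h₂)

/-- RH-FREE.  The convolution of two damped kernels is continuous (integrable ⋆ bounded-continuous). -/
theorem continuous_conv_damped {θ₁ θ₂ : ℝ} (h₁ : 1 < θ₁) (h₂ : 1 < θ₂) :
    Continuous ((fun y : ℝ => (limKernel θ₁ y : ℂ) * Complex.exp (-(y : ℂ))) ⋆[ContinuousLinearMap.mul ℂ ℂ]
      (fun y : ℝ => (limKernel θ₂ y : ℂ) * Complex.exp (-(y : ℂ)))) :=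
  (bddAbove_norm_damped h₂).continuous_convolution_right_of_integrable (L := ContinuousLinearMap.mul ℂ ℂ)
    (integrable_damped h₁) (continuous_damped h₂)

/-- RH-FREE.  `𝓕(f_{θ₁} ⋆ f_{θ₂}) = 𝓕 f_{θ₁+θ₂}` (convolution theorem and `Θ_{θ₁}Θ_{θ₂} = Θ_{θ₁+θ₂}`). -/
theorem fourier_conv_damped {θ₁ θ₂ : ℝ} (h₁ : 1 < θ₁) (h₂ : 1 < θ₂) :
    𝓕 ((fun y : ℝ => (limKernel θ₁ y : ℂ) * Complex.exp (-(y : ℂ))) ⋆[ContinuousLinearMap.mul ℂ ℂ]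
      (fun y : ℝ => (limKernel θ₂ y : ℂ) * Complex.exp (-(y : ℂ)))) =
      𝓕 (fun y : ℝ => (limKernel (θ₁ + θ₂) y : ℂ) * Complex.exp (-(y : ℂ))) := by
  funext ξ
  rw [Real.fourier_mul_convolution_eq (integrable_damped h₁) (integrable_damped h₂) ξ,
    fourier_damped h₁, fourier_damped h₂, fourier_damped (by linarith), limTheta_add]

/-- RH-FREE.  The damped semigroup identity: `f_{θ₁} ⋆ f_{θ₂} = f_{θ₁+θ₂}` as functions on `ℝ`
(Fourier inversion on both sides). -/
theorem conv_damped_eq {θ₁ θ₂ : ℝ} (h₁ : 1 < θ₁) (h₂ : 1 < θ₂) :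
    ((fun y : ℝ => (limKernel θ₁ y : ℂ) * Complex.exp (-(y : ℂ))) ⋆[ContinuousLinearMap.mul ℂ ℂ]
      (fun y : ℝ => (limKernel θ₂ y : ℂ) * Complex.exp (-(y : ℂ)))) =
      fun y : ℝ => (limKernel (θ₁ + θ₂) y : ℂ) * Complex.exp (-(y : ℂ)) := by
  have h12 : 1 < θ₁ + θ₂ := by linarith
  have hA := (continuous_conv_damped h₁ h₂).fourierInv_fourier_eq (integrable_conv_damped h₁ h₂)
    (by rw [fourier_conv_damped h₁ h₂]; exact integrable_fourier_damped h12)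
  have hB := (continuous_damped h12).fourierInv_fourier_eq (integrable_damped h12)
    (integrable_fourier_damped h12)
  rw [← hA, ← hB, fourier_conv_damped h₁ h₂]

/-! ## §4 The semigroup law for `K_θ` -/

/-- **RH-FREE · Suzuki's kernels form a convolution semigroup**: for `θ₁, θ₂ > 1` and every real `x`,
`K_{θ₁+θ₂}(x) = ∫_ℝ K_{θ₁}(t) K_{θ₂}(x − t) dt`. -/
theorem limKernel_add_eq_integral {θ₁ θ₂ : ℝ} (h₁ : 1 < θ₁) (h₂ : 1 < θ₂) (x : ℝ) :
    limKernel (θ₁ + θ₂) x = ∫ t : ℝ, limKernel θ₁ t * limKernel θ₂ (x - t) := by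
  have h := congrFun (conv_damped_eq h₁ h₂) x
  rw [convolution_mul] at h
  -- `∫ K₁(t)e^{−t} K₂(x−t)e^{−(x−t)} dt = e^{−x} ∫ K₁(t)K₂(x−t) dt`
  have hint : ∫ t : ℝ, (limKernel θ₁ t : ℂ) * Complex.exp (-(t : ℂ)) *
      ((limKernel θ₂ (x - t) : ℂ) * Complex.exp (-((x - t : ℝ) : ℂ))) =
      Complex.exp (-(x : ℂ)) * ∫ t : ℝ, ((limKernel θ₁ t * limKernel θ₂ (x - t) : ℝ) : ℂ) := by
    rw [← integral_const_mul]
    congr 1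
    funext t
    have e : Complex.exp (-(t : ℂ)) * Complex.exp (-((x - t : ℝ) : ℂ)) = Complex.exp (-(x : ℂ)) := by
      rw [← Complex.exp_add]; congr 1; push_cast; ring
    rw [Complex.ofReal_mul]
    linear_combination ((limKernel θ₁ t : ℂ) * (limKernel θ₂ (x - t) : ℂ)) * e
  rw [hint, integral_complex_ofReal] at h
  have hexp : Complex.exp (-(x : ℂ)) ≠ 0 := Complex.exp_ne_zero _
  have h' : ((∫ t : ℝ, limKernel θ₁ t * limKernel θ₂ (x - t) : ℝ) : ℂ) = (limKernel (θ₁ + θ₂) x : ℂ) := by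
    exact mul_left_cancel₀ hexp (h.trans (mul_comm _ _))
  exact_mod_cast h'.symm

/-- **RH-FREE · the typed `KernelSemigroup` shape**: for `θ₁, θ₂ > 1` and every real `x`,
`K_{θ₁+θ₂}(x) = ∫_{(0,x)} K_{θ₁}(x − y) K_{θ₂}(y) dy` — the kernels vanish on `(−∞, 0]` ([Su20] (K-iii) and
`K_θ(0) = 0`), so the convolution over `ℝ` folds to the one-sided window. -/
theorem limKernel_add_eq_setIntegral_Ioo {θ₁ θ₂ : ℝ} (h₁ : 1 < θ₁) (h₂ : 1 < θ₂) (x : ℝ) :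
    limKernel (θ₁ + θ₂) x = ∫ y in Ioo 0 x, limKernel θ₁ (x - y) * limKernel θ₂ y := by
  rw [add_comm, limKernel_add_eq_integral h₂ h₁ x]
  rw [setIntegral_eq_integral_of_forall_compl_eq_zero]
  · congr 1; funext y; ring
  intro y hy
  simp only [mem_Ioo, not_and_or, not_lt] at hy
  rcases hy with hy | hy
  · rcases eq_or_lt_of_le hy with rfl | hy'
    · rw [limKernel_zero h₂, mul_zero]
    · rw [Suzuki2020_thm12_Kiii h₂ hy', mul_zero]
  · rcases eq_or_lt_of_le hy with hxy | hy'
    · rw [show x - y = 0 by linarith, limKernel_zero h₁, zero_mul]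
    · rw [Suzuki2020_thm12_Kiii h₁ (by linarith), zero_mul]

end Summit.RiemannHypothesis.RiemannHypothesis.Theorems.SuzukiKernelSemigroup

end
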